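import Literature.Probability.Percolation.SlabRSWGluingBound
import HarnessLib

/-!
# Newman–Tassion–Wu 2017, §3.2 — the linear gluing bound with a BYSTANDER: arbitrary window,
# arbitrary source and target events, local modifications of two kinds

Topic: `Literature/Probability/Percolation`.  `SlabRSWGluingBound.lean` proves NTW's Lemma-3.5 step
(`real_evXn_le_of_gadgets`: `P[𝒳] ≤ λ^s P[C ⟷^R A]` from one `GadgetSpec` per lattice configuration)
for the events `𝒳 = evXn` and `C ⟷^R A` and the window `R̄.sym2`.  The corner gluings of NTW's
Theorem 3.10 ((3.121)–(3.122): "`P[Γ₁ ⟷ L(S₂′), E] ≥ c₃ P[E]`") carry a BYSTANDER event `E` along: the map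
`Φ` acts on `𝒳 ∩ E` with values in `{C ⟷ A} ∩ E`.  This file states the same probabilistic step for

* an arbitrary finite window `K' ⊇ R̄.sym2` (so that a bystander determined by finitely many pairs
  can be absorbed into the source and target events),
* arbitrary events `E` (source) and `F` (target) determined by `K'`,
* local modifications that are either a `GadgetSpec` (cleared set in a box of radius `r` read off the
  image through one of the three recovery statistics) or a modification confined to the columns over
  a FIXED finite set of cells `Zfix` (no recovery statistic needed: the window is known in advance).

Main result: **`real_le_of_mods`**: `P_p[E] ≤ λ^{3(5k+4)(4r+1)² + (5k+4)|Zfix|} · P_p[F]`,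
`λ = 2/min{p,1-p}`.  The proof is that of `real_evXn_le_of_gadgets` with the recovery window enlarged
by the pairs over `Zfix`.

## Sources

* C. M. Newman, V. Tassion, W. Wu, *Critical percolation and the minimal spanning tree in slabs*,
  Comm. Pure Appl. Math. 70 (2017), arXiv:1512.09107: §3.2, Lemma 3.5 and the proof of Theorem 3.7
  (second part), §3.4, proof of Theorem 3.10, (3.121)–(3.122) (the map `Φ` on `{Γ₁ ↮ L(S₂′), E}`)
  [NewmanTassionWu2017].
-/

noncomputable section

namespace Literature.Probability.Percolation

open MeasureTheory LatticeModels SimpleGraph Finset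

namespace NTW17

variable {k : ℕ}

/-- **NTW's Lemma-3.5 step with a bystander, abstract form.**  Let `Q` be a gluing datum, `K'` a finite
window of pairs containing `R̄.sym2`, `E` and `F` events determined by `K'`.  Suppose every lattice
configuration `ω ∈ E` admits `ω' ∈ F` with `ω' ⊆ ω ∪ {lattice pairs of R̄}` which is either a
`GadgetSpec` image of `ω` (radius `r`) or agrees with `ω` off the pairs touching the columns over a
subset of the fixed finite set `Zfix`.  Then `P_p[E] ≤ λ^s · P_p[F]` with `λ = 2/min{p,1-p}` and
`s = 3(5k+4)(4r+1)² + (5k+4)|Zfix|`.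
[cite: NewmanTassionWu2017, §3.2 (Lemma 3.5; proof of Theorem 3.7, second part) and §3.4 (proof of Theorem 3.10, the map Φ of (3.121))] -/
theorem real_le_of_mods (Q : GlueData) {r : ℕ} (Zfix : Finset (ℤ × ℤ)) (K' : Finset (Sym2 (slab 3 k)))
    (hK'R : (slabLift k Q.R).sym2 ⊆ ↑K') {E F : Set (BondConfig (slab 3 k))}
    (hE : DeterminedBy E ↑K') (hF : DeterminedBy F ↑K') (p : unitInterval) (hp0 : 0 < (p : ℝ))
    (hp1 : (p : ℝ) < 1)
    (hmod : ∀ ω : BondConfig (slab 3 k), ω ⊆ (slabGraph 3 k).edgeSet → ω ∈ E → ∃ ω', ω' ∈ F ∧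
      (GadgetSpec Q k r ω ω' ∨
        ((∀ e ∈ ω', e ∈ ω ∨ (e ∈ (slabGraph 3 k).edgeSet ∧ e ∈ (slabLift k Q.R).sym2)) ∧
          ∃ D : Set (ℤ × ℤ), D ⊆ ↑Zfix ∧ ∀ e, e ∉ touch k D → (e ∈ ω ↔ e ∈ ω')))) :
    (bondPercolation (slabGraph 3 k) p).real E ≤
      (2 / min (p : ℝ) (1 - p)) ^ (3 * ((5 * k + 4) * (2 * (2 * r) + 1) ^ 2) + (5 * k + 4) * Zfix.card) *
        (bondPercolation (slabGraph 3 k) p).real F := by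
  classical
  set P := bondPercolation (slabGraph 3 k) p with hP
  -- the chosen modification
  let gad : ∀ ω : BondConfig (slab 3 k), ω ⊆ (slabGraph 3 k).edgeSet ∧ ω ∈ E → BondConfig (slab 3 k) :=
    fun ω h => Classical.choose (hmod ω h.1 h.2)
  have hgad' : ∀ ω (h : ω ⊆ (slabGraph 3 k).edgeSet ∧ ω ∈ E), gad ω h ∈ F ∧
      (GadgetSpec Q k r ω (gad ω h) ∨
        ((∀ e ∈ gad ω h, e ∈ ω ∨ (e ∈ (slabGraph 3 k).edgeSet ∧ e ∈ (slabLift k Q.R).sym2)) ∧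
          ∃ D : Set (ℤ × ℤ), D ⊆ ↑Zfix ∧ ∀ e, e ∉ touch k D → (e ∈ ω ↔ e ∈ gad ω h))) :=
    fun ω h => Classical.choose_spec (hmod ω h.1 h.2)
  have hwin : ∀ ω (h : ω ⊆ (slabGraph 3 k).edgeSet ∧ ω ∈ E),
      ∀ e ∈ gad ω h, e ∈ ω ∨ (e ∈ (slabGraph 3 k).edgeSet ∧ e ∈ (slabLift k Q.R).sym2) := by
    intro ω h e he
    rcases (hgad' ω h).2 with hg | ⟨hw, -⟩
    · exact hg.window e he
    · exact hw e he
  -- lattice pairs of the window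
  set Kfin : Finset (Sym2 (slab 3 k)) := K'.filter (· ∈ (slabGraph 3 k).edgeSet) with hKfin
  have hK : ∀ e, e ∈ Kfin ↔ e ∈ K' ∧ e ∈ (slabGraph 3 k).edgeSet := fun e => Finset.mem_filter
  have hKE : ∀ e ∈ Kfin, e ∈ (slabGraph 3 k).edgeSet := fun e he => ((hK e).1 he).2
  -- lattice configurations inside the window
  have hlat : ∀ S : Finset (Sym2 (slab 3 k)), S ⊆ Kfin →
      (↑S : Set (Sym2 (slab 3 k))) ⊆ (slabGraph 3 k).edgeSet := fun S hS e he => hKE e (hS he)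
  have hnewK : ∀ (S : Finset (Sym2 (slab 3 k))) (hS : S ⊆ Kfin) (hSX : (↑S : BondConfig (slab 3 k)) ∈ E),
      gad ↑S ⟨hlat S hS, hSX⟩ ⊆ ↑Kfin := by
    intro S hS hSX e he
    rcases hwin (↑S) ⟨hlat S hS, hSX⟩ e he with h | ⟨h1, h2⟩
    · exact hS h
    · rw [Finset.mem_coe, hK]
      exact ⟨hK'R h2, h1⟩
  have hcoe : ∀ (S : Finset (Sym2 (slab 3 k))) (hS : S ⊆ Kfin) (hSX : (↑S : BondConfig (slab 3 k)) ∈ E),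
      (↑(Kfin.filter (· ∈ gad ↑S ⟨hlat S hS, hSX⟩)) : Set (Sym2 (slab 3 k))) =
        gad ↑S ⟨hlat S hS, hSX⟩ := by
    intro S hS hSX
    ext e
    simp only [Finset.coe_filter, Set.mem_setOf_eq, and_iff_right_iff_imp]
    exact fun he => hnewK S hS hSX he
  -- the (single-valued) map
  set Φ : Finset (Sym2 (slab 3 k)) → Finset (Finset (Sym2 (slab 3 k))) := fun S =>
    if h : (↑S : Set (Sym2 (slab 3 k))) ⊆ (slabGraph 3 k).edgeSet ∧ (↑S : BondConfig (slab 3 k)) ∈ E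
    then {Kfin.filter (· ∈ gad ↑S h)} else ∅ with hΦ
  have hΦ_of : ∀ (S : Finset (Sym2 (slab 3 k)))
      (h : (↑S : Set (Sym2 (slab 3 k))) ⊆ (slabGraph 3 k).edgeSet ∧ (↑S : BondConfig (slab 3 k)) ∈ E),
      Φ S = {Kfin.filter (· ∈ gad ↑S h)} := fun S h => dif_pos h
  set lam : ℝ := 2 / min (p : ℝ) (1 - p) with hlam
  set s₀ : ℕ := (5 * k + 4) * (2 * (2 * r) + 1) ^ 2 with hs₀
  set s₁ : ℕ := (5 * k + 4) * Zfix.card with hs₁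
  set s : ℕ := 3 * s₀ + s₁ with hs
  -- the window around a vertex
  let box : slab 3 k → Finset (Sym2 (slab 3 k)) := fun q₀ =>
    Kfin.filter fun e => ∃ u ∈ e, planar k u ∈ (sqBox_finite (planar k q₀) (2 * r)).toFinset
  have hbox_card : ∀ q₀, (box q₀).card ≤ s₀ := by
    intro q₀
    refine (card_filter_colEdges_le k Kfin hKE _).trans ?_
    have := card_toFinset_sqBox_le (planar k q₀) (2 * r)
    rw [hs₀]; exact Nat.mul_le_mul_left _ this
  -- the fixed window over `Zfix`
  let Tfix : Finset (Sym2 (slab 3 k)) := Kfin.filter fun e => ∃ u ∈ e, planar k u ∈ Zfix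
  have hTfix_card : Tfix.card ≤ s₁ := by
    rw [hs₁]; exact card_filter_colEdges_le k Kfin hKE _
  -- agreement off the window, for a cleared set inside the box
  have hbox_agree : ∀ (S S' : Finset (Sym2 (slab 3 k))) (D : Set (ℤ × ℤ)) (q₀ : slab 3 k),
      S ⊆ Kfin → S' ⊆ Kfin → planar k q₀ ∈ D → (∃ z : ℤ × ℤ, D ⊆ sqBox z r) →
      (∀ e, e ∉ touch k D → (e ∈ (↑S : BondConfig (slab 3 k)) ↔ e ∈ (↑S' : BondConfig (slab 3 k)))) →
      ∀ e, e ∉ box q₀ → (e ∈ S ↔ e ∈ S') := by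
    intro S S' D q₀ hS hS' hq₀D hz hag e heT
    obtain ⟨z, hDz⟩ := hz
    have hDq : D ⊆ sqBox (planar k q₀) (2 * r) := hDz.trans (sqBox_subset_double (hDz hq₀D))
    by_cases heK : e ∈ Kfin
    · have hnt : e ∉ touch k D := by
        rintro ⟨x, hx, hxD⟩
        exact heT (Finset.mem_filter.2 ⟨heK, x, hx, (Set.Finite.mem_toFinset _).2 (hDq hxD)⟩)
      have := hag e hnt
      simp only [Finset.mem_coe] at this
      exact this
    · constructor
      · intro heS; exact absurd (hS heS) heK
      · intro heS'; exact absurd (hS' heS') heK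
  -- agreement off the fixed window, for a cleared set inside `Zfix`
  have hfix_agree : ∀ (S S' : Finset (Sym2 (slab 3 k))) (D : Set (ℤ × ℤ)),
      S ⊆ Kfin → S' ⊆ Kfin → D ⊆ ↑Zfix →
      (∀ e, e ∉ touch k D → (e ∈ (↑S : BondConfig (slab 3 k)) ↔ e ∈ (↑S' : BondConfig (slab 3 k)))) →
      ∀ e, e ∉ Tfix → (e ∈ S ↔ e ∈ S') := by
    intro S S' D hS hS' hDZ hag e heT
    by_cases heK : e ∈ Kfin
    · have hnt : e ∉ touch k D := by
        rintro ⟨x, hx, hxD⟩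
        exact heT (Finset.mem_filter.2 ⟨heK, x, hx, hDZ hxD⟩)
      have := hag e hnt
      simp only [Finset.mem_coe] at this
      exact this
    · constructor
      · intro heS; exact absurd (hS heS) heK
      · intro heS'; exact absurd (hS' heS') heK
  have hmain := lemma7_bond (slabGraph 3 k) p hp0 hp1 K' Kfin hK hE hF s zero_lt_one Φ ?_ ?_ ?_
  · calc P.real E ≤ lam ^ s / 1 * P.real F := hmain
      _ = lam ^ s * P.real F := by rw [div_one]
  · -- the image lies in `F`
    intro S hS hSA S' hS'
    have h : (↑S : Set (Sym2 (slab 3 k))) ⊆ (slabGraph 3 k).edgeSet ∧ (↑S : BondConfig (slab 3 k)) ∈ E :=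
      ⟨hlat S hS, hSA⟩
    rw [hΦ_of S h, Finset.mem_singleton] at hS'
    subst hS'
    refine ⟨Finset.filter_subset _ _, ?_⟩
    rw [hcoe S hS hSA]
    exact (hgad' (↑S) h).1
  · -- one image
    intro S hS hSA
    have h : (↑S : Set (Sym2 (slab 3 k))) ⊆ (slabGraph 3 k).edgeSet ∧ (↑S : BondConfig (slab 3 k)) ∈ E :=
      ⟨hlat S hS, hSA⟩
    rw [hΦ_of S h]
    simp
  · -- recovery window
    intro S' hS' _
    set ω' : BondConfig (slab 3 k) := ↑S' with hω'
    set T₁ : Finset (Sym2 (slab 3 k)) :=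
      if h : (Q.att k ω').Nonempty then box h.some else ∅ with hT₁
    set T₂ : Finset (Sym2 (slab 3 k)) :=
      if h : (attT k Q.R Q.C Q.A ω').Nonempty then box h.some else ∅ with hT₂
    set T₃ : Finset (Sym2 (slab 3 k)) :=
      if h : (attT k Q.R Q.A Q.C ω').Nonempty then box h.some else ∅ with hT₃
    have hT₁c : T₁.card ≤ s₀ := by rw [hT₁]; split_ifs <;> simp [hbox_card]
    have hT₂c : T₂.card ≤ s₀ := by rw [hT₂]; split_ifs <;> simp [hbox_card]
    have hT₃c : T₃.card ≤ s₀ := by rw [hT₃]; split_ifs <;> simp [hbox_card]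
    refine ⟨T₁ ∪ T₂ ∪ T₃ ∪ Tfix, ?_, ?_⟩
    · calc (T₁ ∪ T₂ ∪ T₃ ∪ Tfix).card ≤ (T₁ ∪ T₂ ∪ T₃).card + Tfix.card := Finset.card_union_le _ _
        _ ≤ ((T₁ ∪ T₂).card + T₃.card) + Tfix.card := by gcongr; exact Finset.card_union_le _ _
        _ ≤ ((T₁.card + T₂.card) + T₃.card) + Tfix.card := by gcongr; exact Finset.card_union_le _ _
        _ ≤ ((s₀ + s₀) + s₀) + s₁ := by omega
        _ = s := by rw [hs]; ring
    · intro S hS hSA hmem e heT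
      have h : (↑S : Set (Sym2 (slab 3 k))) ⊆ (slabGraph 3 k).edgeSet ∧ (↑S : BondConfig (slab 3 k)) ∈ E :=
        ⟨hlat S hS, hSA⟩
      rw [hΦ_of S h, Finset.mem_singleton] at hmem
      have hω'eq : ω' = gad ↑S h := by rw [hω', hmem, hcoe S hS hSA]
      simp only [Finset.mem_union, not_or] at heT
      obtain ⟨⟨⟨heT₁, heT₂⟩, heT₃⟩, heT₄⟩ := heT
      rcases (hgad' ↑S h).2 with hg | ⟨-, D, hDZ, hag⟩
      · obtain ⟨D, hag, hz, hstat⟩ := hg.recover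
        have hag' : ∀ e', e' ∉ touch k D →
            (e' ∈ (↑S : BondConfig (slab 3 k)) ↔ e' ∈ (↑S' : BondConfig (slab 3 k))) := by
          intro e' he'
          rw [show ((↑S' : BondConfig (slab 3 k))) = gad ↑S h from hω' ▸ hω'eq]
          exact hag e' he'
        rcases hstat with ⟨hne, hsub⟩ | ⟨hne, hsub⟩ | ⟨hne, hsub⟩
        · rw [← hω'eq] at hne hsub
          have hT₁' : T₁ = box hne.some := by rw [hT₁, dif_pos hne]
          have hq₀D : planar k hne.some ∈ D := by
            have := hsub hne.some_mem; rwa [mem_slabLift_iff] at this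
          exact hbox_agree S S' D hne.some hS hS' hq₀D hz hag' e (hT₁' ▸ heT₁)
        · rw [← hω'eq] at hne hsub
          have hT₂' : T₂ = box hne.some := by rw [hT₂, dif_pos hne]
          have hq₀D : planar k hne.some ∈ D := by
            have := hsub hne.some_mem; rwa [mem_slabLift_iff] at this
          exact hbox_agree S S' D hne.some hS hS' hq₀D hz hag' e (hT₂' ▸ heT₂)
        · rw [← hω'eq] at hne hsub
          have hT₃' : T₃ = box hne.some := by rw [hT₃, dif_pos hne]
          have hq₀D : planar k hne.some ∈ D := by
            have := hsub hne.some_mem; rwa [mem_slabLift_iff] at this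
          exact hbox_agree S S' D hne.some hS hS' hq₀D hz hag' e (hT₃' ▸ heT₃)
      · have hag' : ∀ e', e' ∉ touch k D →
            (e' ∈ (↑S : BondConfig (slab 3 k)) ↔ e' ∈ (↑S' : BondConfig (slab 3 k))) := by
          intro e' he'
          rw [show ((↑S' : BondConfig (slab 3 k))) = gad ↑S h from hω' ▸ hω'eq]
          exact hag e' he'
        exact hfix_agree S S' D hS hS' hDZ hag' e heT₄

/-- **Bystander form of the linear gluing bound.**  With `G` an event determined by a finite set of pairs
`T`, window `K' = (R̄.sym2)ᶠⁱⁿ ∪ T`, source `E₀ ∩ G` and target `F₀ ∩ G` for `E₀`, `F₀` determined by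
`R̄.sym2`: if every lattice `ω ∈ E₀ ∩ G` has a modification `ω' ∈ F₀ ∩ G` as in `real_le_of_mods`, then
`P_p[E₀ ∩ G] ≤ λ^s P_p[F₀ ∩ G]`.  (Instance of `real_le_of_mods`; recorded for the shape of its use in
the corner gluings of Theorem 3.10.) [cite: NewmanTassionWu2017, §3.4 (proof of Theorem 3.10, (3.121): "Φ : {Γ₁ ↮ L(S₂′), E} → {Γ₁ ⟷ L(S₂′), E}")] -/
theorem real_inter_le_of_mods (Q : GlueData) {r : ℕ} (Zfix : Finset (ℤ × ℤ)) (T : Finset (Sym2 (slab 3 k)))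
    {E₀ F₀ G : Set (BondConfig (slab 3 k))}
    (hE₀ : DeterminedBy E₀ (slabLift k Q.R).sym2) (hF₀ : DeterminedBy F₀ (slabLift k Q.R).sym2)
    (hG : DeterminedBy G ↑T) (p : unitInterval) (hp0 : 0 < (p : ℝ)) (hp1 : (p : ℝ) < 1)
    (hmod : ∀ ω : BondConfig (slab 3 k), ω ⊆ (slabGraph 3 k).edgeSet → ω ∈ E₀ ∩ G → ∃ ω', ω' ∈ F₀ ∩ G ∧
      (GadgetSpec Q k r ω ω' ∨
        ((∀ e ∈ ω', e ∈ ω ∨ (e ∈ (slabGraph 3 k).edgeSet ∧ e ∈ (slabLift k Q.R).sym2)) ∧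
          ∃ D : Set (ℤ × ℤ), D ⊆ ↑Zfix ∧ ∀ e, e ∉ touch k D → (e ∈ ω ↔ e ∈ ω')))) :
    (bondPercolation (slabGraph 3 k) p).real (E₀ ∩ G) ≤
      (2 / min (p : ℝ) (1 - p)) ^ (3 * ((5 * k + 4) * (2 * (2 * r) + 1) ^ 2) + (5 * k + 4) * Zfix.card) *
        (bondPercolation (slabGraph 3 k) p).real (F₀ ∩ G) := by
  classical
  have hRfin : (slabLift k Q.R).Finite := slabLift_finite k Q.hRfin
  set KR : Finset (Sym2 (slab 3 k)) := (finite_sym2 hRfin).toFinset with hKR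
  have hKRcoe : (↑KR : Set (Sym2 (slab 3 k))) = (slabLift k Q.R).sym2 := Set.Finite.coe_toFinset _
  set K' : Finset (Sym2 (slab 3 k)) := KR ∪ T with hK'
  have hK'R : (slabLift k Q.R).sym2 ⊆ ↑K' := by
    rw [hK', Finset.coe_union, ← hKRcoe]; exact Set.subset_union_left
  have hTK : (↑T : Set (Sym2 (slab 3 k))) ⊆ ↑K' := by rw [hK', Finset.coe_union]; exact Set.subset_union_right
  have hE : DeterminedBy (E₀ ∩ G) ↑K' := (hE₀.mono hK'R).inter (hG.mono hTK)
  have hF : DeterminedBy (F₀ ∩ G) ↑K' := (hF₀.mono hK'R).inter (hG.mono hTK)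
  exact real_le_of_mods Q Zfix K' hK'R hE hF p hp0 hp1 hmod

end NTW17

end Literature.Probability.Percolation

end
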